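import Literature.AnabelianGeometry.EtaleTheta.RigidOfSetting
import Literature.AnabelianGeometry.EtaleTheta.Discharge.Sec2ThetaGroupHcomm
import Literature.AnabelianGeometry.EtaleTheta.Discharge.Sec2SymmetryProofs
import Literature.AnabelianGeometry.AbsoluteAnabelian.MLFSlimKummerProofs
import HarnessLib

/-!
# [EtTh] Prop 2.12 (i) / Prop 2.14 (i) for the §1 model: `hcomm` and `Prop214_i` for `rigidData`
# (proof-only companion; item N8 of abc-iut-L2-t8's adapter report)

Mochizuki, *The étale theta function and its Frobenioid-theoretic manifestations*, Publ. RIMS **45**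
(2009) [EtTh], §2 Prop. 2.12 (i) p. 45 and Prop. 2.14 (i) pp. 49–50 (PRIMS PDF pages; bib key
`MochizukiEtTh2009`).  Layer L2 of the abc-iut cell, seat abc-iut-L5-t14 (cross-layer, N8).
PROOF-ONLY: repackages `Sec2ThetaGroupHcomm.lean` for abc-iut-L2-t8's instantiated rigidity data
`C.rigidData μ hC hS h15 L : RigidData N l` (`RigidOfSetting.lean`) in the LITERAL shape of the
hypothesis `hcomm` of abc-iut-L2-t10's `RigidData.prop214_i_of_commutators`
(`Discharge/Sec2SymmetryProofs.lean`), and combines it with t8's `aug_eq_one_of_forall_conj_of_slim`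
and abc-iut-L4-d2's `galoisMLF_slim_holds` ([AbsAnab] Thm 1.1.1 (ii), PROVED) into
**`Prop214_i` for the §1 model**, conditional on exactly: `D.IsEtThOrigin` ("`Δ_X` is a profinite
free group on 2 generators", p. 12) and the p. 12–13 sentence "(Δ^tp_Y)^Θ is an abelian profinite
group" (binders `hYab`, `hYcl`).

* `rigidData_hcomm` — `∀ t : Π^tp_X̲̲, t ∈ lDeltaTheta ↔ ∃ z ∈ Ker aug, ∃ b ∈ Π^tp_Y̲̲ ⊓ Ker aug,
  ∃ k ∈ thetaKer, t = z b z⁻¹ b⁻¹ k` (`⊆`: `exists_commutator_of_toTheta_mem_lDeltaTheta`; `⊇`: t8's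
  `commutator_mem_comap_lDeltaTheta`);
* `rigidData_prop214_i` — `(C.rigidData μ hC hS h15 L).Prop214_i`.
HONEST FRAMING: [EtTh] is refereed; the setting is data quoting print and is not asserted to exist;
`rigidData` itself is conditional on the named fact `Prop15iii` (its parameter `h15`); nothing here
takes a side on any disputed claim.
-/

noncomputable section

namespace Literature.AnabelianGeometry.EtaleTheta

open Literature.AnabelianGeometry.SemiGraphs

namespace ThetaSetting

namespace EtaleThetaData.DoubleUnderline

variable {p : ℕ} [Fact p.Prime] {D : ThetaSetting p} {E : D.EtaleThetaData} {l : ℕ}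
  (C : E.DoubleUnderline l) {N : ℕ+} (μ : D.CyclotomeMod l N)

/-- Membership in `Ker(aug)` of the instantiated data is membership in `Δ^tp_X`.
[cite: MochizukiEtTh2009, Def 2.13 p.47] -/
theorem mem_ker_aug_rigidData_iff (hC : D.Compat) (hS : D.Sec2Hyps) (h15 : Prop15iii E hC)
    (L : C.CuspLabels) (x : C.Huu) :
    x ∈ (C.rigidData μ hC hS h15 L).aug.ker ↔ (x : D.PiTemp) ∈ D.DeltaTemp := by
  change x ∈ ((D.aug.toMonoidHom.comp C.Huu.subtype).codRestrict D.GK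
    fun x => D.aug_mem_GK (x : D.PiTemp)).ker ↔ _
  rw [MonoidHom.ker_codRestrict, MonoidHom.mem_ker, MonoidHom.coe_comp, Function.comp_apply,
    Subgroup.coe_subtype]
  rfl

/-- **`hcomm` for the §1 model** ([EtTh] Prop. 2.12 (i), p. 45; abc-iut-L2-t10's hypothesis in its
literal shape): for t8's `rigidData`, an element of `Π^tp_X̲̲` maps into `l·Δ_Θ` iff it is
`z b z⁻¹ b⁻¹ k` with `z ∈ Δ^tp_X̲̲`, `b ∈ Δ^tp_Y̲̲`, `k ∈ Ker(Π^tp_X̲̲ → (Π^tp_X)^Θ)` — modulo `IsEtThOrigin` and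
the p. 12–13 hypotheses `hYab`, `hYcl` ("(Δ^tp_Y)^Θ abelian profinite").
[cite: MochizukiEtTh2009, Prop 2.12 (i) p.45] -/
theorem rigidData_hcomm (hC : D.Compat) (hS : D.Sec2Hyps) (h15 : Prop15iii E hC) (L : C.CuspLabels)
    (hO : D.IsEtThOrigin) (hYab : ∀ x ∈ D.DtpYTheta, ∀ y ∈ D.DtpYTheta, x * y = y * x)
    (hYcl : (D.DtpY.map D.toHat.toMonoidHom).topologicalClosure ≤
      D.DtpY.map D.toHat.toMonoidHom ⊔ (⁅⁅D.DeltaHat, D.DeltaHat⁆, D.DeltaHat⁆).topologicalClosure) :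
    ∀ t : (C.rigidData μ hC hS h15 L).PiX, t ∈ (C.rigidData μ hC hS h15 L).lDeltaTheta ↔
      ∃ z ∈ (C.rigidData μ hC hS h15 L).aug.ker,
        ∃ b ∈ (C.rigidData μ hC hS h15 L).PiY ⊓ (C.rigidData μ hC hS h15 L).aug.ker,
          ∃ k ∈ (C.rigidData μ hC hS h15 L).thetaKer, t = z * b * z⁻¹ * b⁻¹ * k := by
  intro t
  constructor
  · intro ht
    have ht' : D.toTheta ((t : C.Huu) : D.PiTemp) ∈ D.lDeltaTheta l := ht
    obtain ⟨z, hzH, b, hbH, k, hkH, hzΔ, hbY, hbΔ, hk1, heq⟩ :=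
      C.exists_commutator_of_toTheta_mem_lDeltaTheta hO hYab hYcl (t : C.Huu).2 ht'
    refine ⟨⟨z, hzH⟩, (C.mem_ker_aug_rigidData_iff μ hC hS h15 L _).mpr hzΔ, ⟨b, hbH⟩,
      ⟨Subgroup.mem_subgroupOf.mpr hbY, (C.mem_ker_aug_rigidData_iff μ hC hS h15 L _).mpr hbΔ⟩,
      ⟨k, hkH⟩, ?_, Subtype.ext heq⟩
    exact hk1
  · rintro ⟨z, hz, b, ⟨-, hb⟩, k, hk, rfl⟩
    exact C.commutator_mem_comap_lDeltaTheta z b k ((C.mem_ker_aug_rigidData_iff μ hC hS h15 L _).mp hz)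
      ((C.mem_ker_aug_rigidData_iff μ hC hS h15 L _).mp hb) hk

/-- **[EtTh] Prop. 2.14 (i) for the §1 model** (p. 49: "the subset `{γ(β)·β⁻¹}` … coincides with the image
of the tautological section of `(l·Δ_Θ)[μ_N] ↠ (l·Δ_Θ)`"): the named fact `Prop214_i` HOLDS for t8's
instantiated rigidity data `C.rigidData μ hC hS h15 L`, by abc-iut-L2-t10's reduction
`prop214_i_of_commutators` with `hslim` DISCHARGED (t8's `aug_eq_one_of_forall_conj_of_slim` +
abc-iut-L4-d2's `galoisMLF_slim_holds`) and `hcomm` = `rigidData_hcomm` — conditional on exactly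
`IsEtThOrigin` and the p. 12–13 hypotheses `hYab`, `hYcl`. [cite: MochizukiEtTh2009, Prop 2.14 (i) p.49] -/
theorem rigidData_prop214_i (hC : D.Compat) (hS : D.Sec2Hyps) (h15 : Prop15iii E hC) (L : C.CuspLabels)
    (hO : D.IsEtThOrigin) (hYab : ∀ x ∈ D.DtpYTheta, ∀ y ∈ D.DtpYTheta, x * y = y * x)
    (hYcl : (D.DtpY.map D.toHat.toMonoidHom).topologicalClosure ≤
      D.DtpY.map D.toHat.toMonoidHom ⊔ (⁅⁅D.DeltaHat, D.DeltaHat⁆, D.DeltaHat⁆).topologicalClosure) :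
    (C.rigidData μ hC hS h15 L).Prop214_i :=
  (C.rigidData μ hC hS h15 L).prop214_i_of_commutators
    (fun z hz => C.aug_eq_one_of_forall_conj_of_slim μ hC hS AbsoluteAnabelian.galoisMLF_slim_holds z hz)
    (C.rigidData_hcomm μ hC hS h15 L hO hYab hYcl)

end EtaleThetaData.DoubleUnderline

end ThetaSetting

end Literature.AnabelianGeometry.EtaleTheta

end
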